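import Literature.AlgebraicGeometry.Resolution.ExceptionalDivisorRegular
import Literature.AlgebraicGeometry.Resolution.AffineBlowupUniversal
import Mathlib.AlgebraicGeometry.Morphisms.Flat
import Mathlib.RingTheory.RingHom.Flat
import HarnessLib

/-!
# `EquisingularLift`, line `strata-split` — charts of the exceptional divisor of an affine blow-up (flatness tools)

Crux `stmt-ResolutionOfSingularities-15660` = `Theses.EquisingularLift.EquisingularLift`; tools for the helper
sub-goal `flat_exceptional_of_isBlowup_section` (G3) of the registered stub `stub_resolveOnePoint_dimOne` (section
blow-up calculus over a DVR: the exceptional divisor of the blow-up of `U`, smooth over `Spec O`, along a section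
is flat over `O`; file `EquisingularLiftEquisingularLiftSectionBlowupFlatExceptional`). The content here is the
base-independent part (Liu, *Algebraic Geometry and Arithmetic Curves*, Thm. 8.1.19 (b): the exceptional divisor
of the blow-up along a regular centre is, chart by chart, an affine space over the centre; Stacks 0BIQ):

* `flat_comap_subschemeι_comp`, `flat_subschemeι_comp_of_comap` — transport of flatness of `V(K) → S` along a flat
  morphism / a covering open immersion (`(K.comap f).subscheme ≅ X ×_Y V(K)`, Mathlib's `comapIso`);
* `flat_appLE_subschemeι_comp_iff` — flatness of `V(K) → S` on an affine chart `U`, read through a bijective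
  ring map `Γ(X, U) → T` (`Γ(V(K), V(K) ∩ U) ≅ Γ(X, U)/K(U)`, Mathlib's `subschemeObjIso`);
* `flat_quotient_chart_comp` — for a quasi-regular sequence `x` in `A`, `I = (x)`: `D → (A[It])_{(xᵢt)}/(xᵢ)` is
  flat as soon as `D → A/I` is (`(A[It])_{(xᵢt)}/(xᵢ) ≅ (A/I)[T_j : j ≠ i]`, `ker_quotient_comp_eval₂Hom_eq`);
* `exists_ringHom_exceptional_chartOpen` — the ring of the chart `D₊(bt)` of `Bl_I(Spec A)` is `(A[It])_{(bt)}`,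
  compatibly with the exceptional ideal `(b/1)` and with the structure map from `A`;
* `flat_exceptional_affineBlowup_of_isQuasiRegular` — **the exceptional divisor of `Bl_{(x)}(Spec A)` is flat over
  `Spec D` whenever `D → A/(x)` is flat** (`x` quasi-regular);
* `flat_exceptional_of_isBlowup_of_isAffine` — the same for any blow-up (`IsBlowup`) of an affine scheme
  (registered sub-goal, universe `0`).
-/

set_option linter.dupNamespace false -- mandated namespace `Summit.<Summit>.<Problem>` of this single-conjunct summit

noncomputable section

open CategoryTheory CategoryTheory.Limits AlgebraicGeometry TopologicalSpace Topology
open Literature.AlgebraicGeometry.Resolution HomogeneousLocalization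

namespace Summit.ResolutionOfSingularities.ResolutionOfSingularities.Cruxes.EquisingularLift.StrataSplit

universe u

/-! ## Transport of flatness of a closed subscheme over a base -/

/-- **Flatness of `V(K) → S` pulls back along flat morphisms**: if `V(K) ⊆ Y` is flat over `S` (via `g`) and
`f : X → Y` is flat, then `V(K · 𝒪_X) = X ×_Y V(K)` is flat over `S` (via `f ≫ g`). [folklore] -/
theorem flat_comap_subschemeι_comp {X Y S : Scheme.{u}} (f : X ⟶ Y) [Flat f]
    (K : Y.IdealSheafData) (g : Y ⟶ S) [Flat (K.subschemeι ≫ g)] :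
    Flat ((K.comap f).subschemeι ≫ f ≫ g) := by
  have h : (K.comap f).subschemeι ≫ f ≫ g =
      (K.comapIso f).hom ≫ pullback.snd f K.subschemeι ≫ K.subschemeι ≫ g := by
    rw [← Scheme.IdealSheafData.comapIso_hom_fst_assoc, pullback.condition_assoc]
  rw [h]
  infer_instance

/-- If the open immersion `f : X → Y` covers the support of `K`, then `X ×_Y V(K) → V(K)` is an isomorphism.
[folklore] -/
theorem isIso_pullback_snd_subschemeι {X Y : Scheme.{u}} (f : X ⟶ Y) [IsOpenImmersion f]
    (K : Y.IdealSheafData) (hK : (K.support : Set Y) ⊆ Set.range f) :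
    IsIso (pullback.snd f K.subschemeι) := by
  haveI : Epi (pullback.snd f K.subschemeι).base := by
    rw [TopCat.epi_iff_surjective]
    intro z
    have hz : K.subschemeι z ∈ Set.range f :=
      hK (by rw [← K.range_subschemeι]; exact ⟨z, rfl⟩)
    show z ∈ Set.range (pullback.snd f K.subschemeι)
    rw [IsOpenImmersion.range_pullbackSnd]
    exact hz
  exact IsOpenImmersion.isIso _

/-- **Flatness of `V(K) → S` is detected on an open `X ⊆ Y` containing the support of `K`**: if
`f : X → Y` is an open immersion with `supp K ⊆ f(X)` and `V(K · 𝒪_X) → S` is flat, then `V(K) → S` is flat.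
[folklore] -/
theorem flat_subschemeι_comp_of_comap {X Y S : Scheme.{u}} (f : X ⟶ Y) [IsOpenImmersion f]
    (K : Y.IdealSheafData) (g : Y ⟶ S) (hK : (K.support : Set Y) ⊆ Set.range f)
    [Flat ((K.comap f).subschemeι ≫ f ≫ g)] : Flat (K.subschemeι ≫ g) := by
  haveI := isIso_pullback_snd_subschemeι f K hK
  have h : ((K.comapIso f).hom ≫ pullback.snd f K.subschemeι) ≫ K.subschemeι ≫ g =
      (K.comap f).subschemeι ≫ f ≫ g := by
    rw [Category.assoc, ← pullback.condition_assoc, Scheme.IdealSheafData.comapIso_hom_fst_assoc]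
  have h' : K.subschemeι ≫ g =
      inv ((K.comapIso f).hom ≫ pullback.snd f K.subschemeι) ≫ ((K.comap f).subschemeι ≫ f ≫ g) := by
    rw [← h, IsIso.inv_hom_id_assoc]
  rw [h']
  infer_instance

/-! ## Flatness of a closed subscheme on an affine chart, through a ring identification -/

/-- For `h : X → S` with `S` affine, a closed subscheme `V(K) ⊆ X`, an affine open `U ⊆ X` and a ring
isomorphism `E : Γ(X, U) ≅ T` carrying `K(U)` onto `J`: the ring map `Γ(S, 𝒪) → Γ(V(K), V(K) ∩ U)` is flat iff
`Γ(S, 𝒪) → Γ(X, U) ≅ T → T/J` is flat (`Γ(V(K), V(K) ∩ U) ≅ Γ(X, U)/K(U)`, Mathlib's `subschemeObjIso`).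
[folklore] -/
theorem flat_appLE_subschemeι_comp_iff {X S : Scheme.{u}} (K : X.IdealSheafData) (h : X ⟶ S)
    (U : X.affineOpens) {T : Type u} [CommRing T] (E : Γ(X, U) →+* T) (hE : Function.Bijective E)
    (J : Ideal T) (hJ : (K.ideal U).map E = J) :
    ((K.subschemeι ≫ h).appLE ⊤ (K.subschemeι ⁻¹ᵁ (U : X.Opens)) le_top).hom.Flat ↔
      ((Ideal.Quotient.mk J).comp (E.comp (h.appLE ⊤ U le_top).hom)).Flat := by
  -- adapted from Literature.AlgebraicGeometry.Resolution.flat_ker_subschemeι_comp (StrictTransformFlatteningDedekind)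
  have hcomp : (K.subschemeι ≫ h).appLE ⊤ (K.subschemeι ⁻¹ᵁ (U : X.Opens)) le_top =
      h.appLE ⊤ U le_top ≫ CommRingCat.ofHom (Ideal.Quotient.mk (K.ideal U)) ≫
        (K.subschemeObjIso U).inv := by
    rw [← K.subschemeι_app U, ← Scheme.Hom.appLE_eq_app, Scheme.Hom.appLE_comp_appLE]
  rw [hcomp, ← Category.assoc, CommRingCat.hom_comp, RingHom.Flat.respectsIso.cancel_right_isIso,
    CommRingCat.hom_comp, CommRingCat.hom_ofHom]
  -- `Γ(X, U)/K(U) ≅ T/J` through `E`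
  let E' : Γ(X, U) ≃+* T := RingEquiv.ofBijective E hE
  have hE' : (E' : Γ(X, U) →+* T) = E := RingHom.ext fun _ => rfl
  let qE : (Γ(X, U) ⧸ K.ideal U) ≃+* T ⧸ J := Ideal.quotientEquiv _ _ E' (by rw [hE', hJ])
  have key : (Ideal.Quotient.mk J).comp (E.comp (h.appLE ⊤ U le_top).hom) =
      qE.toRingHom.comp ((Ideal.Quotient.mk (K.ideal U)).comp (h.appLE ⊤ U le_top).hom) := by
    refine RingHom.ext fun a => ?_
    simp only [RingHom.comp_apply, RingEquiv.toRingHom_eq_coe, RingEquiv.coe_toRingHom]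
    exact (Ideal.quotientEquiv_mk (K.ideal U) J E' (by rw [hE', hJ]) _).symm
  rw [key]
  exact (RingHom.Flat.comp_iff_of_bijective_left (g := qE.toRingHom) qE.bijective).symm

/-! ## The chart algebra: `D → (A[It])_{(xᵢt)}/(xᵢ)` is flat when `D → A/I` is -/

section ChartAlgebra

variable {R : Type u} [CommRing R] {r : ℕ} (x : Fin r → R) (i : Fin r)

local notation3 "𝓘" => Ideal.span (Set.range x)
local notation3 "B" => HomogeneousLocalization.Away (reesGrading 𝓘)
  (reesT (x i) (Ideal.mem_span_range_self (f := x) (x := i)))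
local notation3 "φ" => reesChartBase (x i) (Ideal.mem_span_range_self (f := x) (x := i))
local notation3 "e[" j "]" =>
  HomogeneousLocalization.Away.mk (reesGrading 𝓘)
    (reesT_mem (x i) (Ideal.mem_span_range_self (f := x) (x := i))) 1
    (reesT (x j) (Ideal.mem_span_range_self (f := x) (x := j))) (reesT_mem_one_smul x j)

/-- **The chart of the exceptional divisor is flat over the base**: for a quasi-regular sequence `x` in `R`,
`I = (x)`, and a ring map `θ : D → R` with `D → R/I` flat, the composite `D → R → (R[It])_{(xᵢt)} → (R[It])_{(xᵢt)}/(xᵢ)`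
is flat — it factors as `D → R/I → (R/I)[T_j : j ≠ i] ≅ (R[It])_{(xᵢt)}/(xᵢ)` (`ker_quotient_comp_eval₂Hom_eq`,
Stacks 0BIQ for quasi-regular sequences), a flat map followed by a free algebra.
[cite: StacksProject, Tag 0BIQ] -/
theorem flat_quotient_chart_comp (hx : IsQuasiRegular x) {D : Type u} [CommRing D] (θ : D →+* R)
    (hθ : ((Ideal.Quotient.mk 𝓘).comp θ).Flat) :
    ((Ideal.Quotient.mk (Ideal.span {φ (x i)})).comp ((φ).comp θ)).Flat := by
  classical
  -- `ψ : R/I → B/(φ xᵢ)` induced by `φ`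
  have hIJ : ∀ a ∈ 𝓘, (Ideal.Quotient.mk (Ideal.span {φ (x i)})).comp φ a = 0 := fun a ha => by
    rw [RingHom.comp_apply, Ideal.Quotient.eq_zero_iff_mem]
    exact reesChartBase_mem_span_of_mem x i ha
  set ψ : R ⧸ 𝓘 →+* B ⧸ Ideal.span {φ (x i)} :=
    Ideal.Quotient.lift 𝓘 ((Ideal.Quotient.mk (Ideal.span {φ (x i)})).comp φ) hIJ with hψ
  have hfac : (Ideal.Quotient.mk (Ideal.span {φ (x i)})).comp ((φ).comp θ) =
      ψ.comp ((Ideal.Quotient.mk 𝓘).comp θ) := by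
    refine RingHom.ext fun d => ?_
    simp only [RingHom.comp_apply, hψ, Ideal.Quotient.lift_mk]
  rw [hfac]
  refine RingHom.Flat.comp hθ ?_
  -- `ψ = ψ' ∘ C` with `ψ' : (R/I)[T_j : j ≠ i] → B/(φ xᵢ)` bijective (`ker_quotient_comp_eval₂Hom_eq`)
  let g : MvPolynomial {j : Fin r // j ≠ i} R →+* B ⧸ Ideal.span {φ (x i)} :=
    (Ideal.Quotient.mk (Ideal.span {φ (x i)})).comp
      (MvPolynomial.eval₂Hom φ (fun j : {j : Fin r // j ≠ i} => e[j.1]))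
  have hgsurj : Function.Surjective g := quotient_comp_eval₂Hom_surjective x i
  have hgker : RingHom.ker g = Ideal.map MvPolynomial.C 𝓘 := ker_quotient_comp_eval₂Hom_eq x i hx
  let ψ' : MvPolynomial {j : Fin r // j ≠ i} (R ⧸ 𝓘) →+* B ⧸ Ideal.span {φ (x i)} :=
    MvPolynomial.eval₂Hom ψ (fun j : {j : Fin r // j ≠ i} => Ideal.Quotient.mk _ (e[j.1]))
  have hψ'C : ψ'.comp MvPolynomial.C = ψ := MvPolynomial.eval₂Hom_comp_C _ _
  have hψ'map : ψ'.comp (MvPolynomial.map (Ideal.Quotient.mk 𝓘)) = g := by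
    refine MvPolynomial.ringHom_ext (fun a => ?_) (fun j => ?_)
    · rw [RingHom.comp_apply, MvPolynomial.map_C, MvPolynomial.eval₂Hom_C, hψ, Ideal.Quotient.lift_mk]
      change _ = Ideal.Quotient.mk _ (MvPolynomial.eval₂Hom φ
        (fun j : {j : Fin r // j ≠ i} => e[j.1]) (MvPolynomial.C a))
      rw [MvPolynomial.eval₂Hom_C]
      rfl
    · rw [RingHom.comp_apply, MvPolynomial.map_X, MvPolynomial.eval₂Hom_X']
      change _ = Ideal.Quotient.mk _ (MvPolynomial.eval₂Hom φ
        (fun j : {j : Fin r // j ≠ i} => e[j.1]) (MvPolynomial.X j))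
      rw [MvPolynomial.eval₂Hom_X']
  have hmapsurj : Function.Surjective
      (MvPolynomial.map (σ := {j : Fin r // j ≠ i}) (Ideal.Quotient.mk 𝓘)) :=
    MvPolynomial.map_surjective _ Ideal.Quotient.mk_surjective
  have hmapker : RingHom.ker (MvPolynomial.map (σ := {j : Fin r // j ≠ i}) (Ideal.Quotient.mk 𝓘)) =
      Ideal.map MvPolynomial.C 𝓘 := by
    rw [MvPolynomial.ker_map, Ideal.mk_ker]
  have hψ'bij : Function.Bijective ψ' := by
    constructor
    · rw [injective_iff_map_eq_zero]
      intro p hp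
      obtain ⟨P, rfl⟩ := hmapsurj p
      have hP : P ∈ RingHom.ker g := by
        rw [RingHom.mem_ker, ← hψ'map, RingHom.comp_apply, hp]
      rw [hgker, ← hmapker, RingHom.mem_ker] at hP
      exact hP
    · refine Function.Surjective.of_comp (g := MvPolynomial.map (Ideal.Quotient.mk 𝓘)) ?_
      rw [← RingHom.coe_comp, hψ'map]
      exact hgsurj
  rw [← hψ'C]
  refine RingHom.Flat.comp ?_ (RingHom.Flat.of_bijective hψ'bij)
  have hC : (algebraMap (R ⧸ 𝓘) (MvPolynomial {j : Fin r // j ≠ i} (R ⧸ 𝓘))).Flat :=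
    RingHom.flat_algebraMap_iff.mpr inferInstance
  rwa [MvPolynomial.algebraMap_eq] at hC

end ChartAlgebra

/-! ## The ring of a chart of the affine blow-up, compatibly with the exceptional ideal and the base -/

/-- For `b ∈ I`, the ring of sections of `Bl_I(Spec R)` over the chart `D₊(bt)` is `(R[It])_{(bt)}`, by an
isomorphism `E` carrying the exceptional ideal `(I · 𝒪)(D₊(bt))` onto `(b/1)` and the structure map
`Γ(Spec R, 𝒪) → Γ(Bl, D₊(bt))` of `π` onto `φ_b : R → (R[It])_{(bt)}` (the chart morphism followed by `π` is
`Spec φ_b`). [cite: StacksProject, Tag 0804] -/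
theorem exists_ringHom_exceptional_chartOpen {R : Type u} [CommRing R] {I : Ideal R} (b : R) (hb : b ∈ I) :
    ∃ E : Γ(affineBlowup I, affineBlowup.chartOpen (I := I) b hb) →+* Away (reesGrading I) (reesT b hb),
      Function.Bijective E ∧
      ((affineBlowup.exceptionalIdeal I).ideal (affineBlowup.chartOpen b hb)).map E =
          Ideal.span {reesChartBase b hb b} ∧
      E.comp ((affineBlowup.π I).appLE ⊤ (affineBlowup.chartOpen b hb) le_top).hom =
          (reesChartBase b hb).comp (Scheme.ΓSpecIso (.of R)).hom.hom := by
  -- adapted from Literature.AlgebraicGeometry.Resolution.affineBlowup.nonempty_ringEquiv_exceptional_chartOpen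
  let B := Away (reesGrading I) (reesT b hb)
  let j := affineBlowup.chartι (I := I) b hb
  let K := affineBlowup.exceptionalIdeal I
  let ε : Γ(Spec (.of B), ⊤) ≅ CommRingCat.of B := Scheme.ΓSpecIso (.of B)
  let g₀ : Γ(Spec (.of B), ⊤) := ε.inv.hom (reesChartBase b hb b)
  -- the top ideal of the pulled-back exceptional ideal is `(g₀)`
  have h2 : (K.comap j).ideal ⟨⊤, isAffineOpen_top _⟩ = Ideal.span {g₀} := by
    rw [affineBlowup.exceptionalIdeal_comap_chartι, ideal_ofIdealTop_top, map_reesChartBase_eq,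
      Ideal.map_span, Set.image_singleton]
  -- upstairs through `Γ(Bl, j '' ⊤) ≅ Γ(Spec B, ⊤)`
  let e : Γ(affineBlowup I, affineBlowup.chartOpen (I := I) b hb) ≃+* Γ(Spec (.of B), ⊤) :=
    (j.appIso ⊤).commRingCatIsoToRingEquiv
  have h3 : ((K.ideal (affineBlowup.chartOpen b hb)).comap e.symm.toRingHom) = Ideal.span {g₀} := by
    rw [← h2]
    exact (Scheme.IdealSheafData.ideal_comap_of_isOpenImmersion K j ⟨⊤, isAffineOpen_top _⟩).symm
  have h4 : K.ideal (affineBlowup.chartOpen b hb) = (Ideal.span {g₀}).comap e.toRingHom := by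
    rw [← h3, Ideal.comap_comap]
    convert (Ideal.comap_id _).symm
    ext a
    exact e.symm_apply_apply a
  -- and down to `B` through `Γ(Spec B, ⊤) ≅ B`
  let ε' := ε.commRingCatIsoToRingEquiv
  have hg₀ : ε' g₀ = reesChartBase b hb b := by
    change (ε.inv ≫ ε.hom).hom (reesChartBase b hb b) = _
    rw [ε.inv_hom_id]
    rfl
  let E := e.trans ε'
  have h5 : Ideal.span {reesChartBase b hb b} =
      (K.ideal (affineBlowup.chartOpen b hb)).map E.toRingHom := by
    rw [h4, comap_span_singleton_ringEquiv e g₀, Ideal.map_span, Set.image_singleton]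
    change _ = Ideal.span {ε' (e (e.symm g₀))}
    rw [e.apply_symm_apply, hg₀]
  refine ⟨E.toRingHom, E.bijective, h5.symm, ?_⟩
  -- compatibility with the base: `E ∘ π^* = φ_b ∘ (Γ(Spec R, ⊤) ≅ R)`
  have hcomp : (affineBlowup.π I).appLE ⊤ (affineBlowup.chartOpen b hb) le_top ≫ (j.appIso ⊤).hom ≫
      ε.hom = (Scheme.ΓSpecIso (.of R)).hom ≫ CommRingCat.ofHom (reesChartBase b hb) := by
    show (affineBlowup.π I).appLE ⊤ (j ''ᵁ ⊤) le_top ≫ (j.appIso ⊤).hom ≫ ε.hom = _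
    rw [Scheme.Hom.appIso_hom', Scheme.Hom.appLE_comp_appLE_assoc]
    have key : ∀ (h : (⊤ : (Spec (.of B)).Opens) ≤ (j ≫ affineBlowup.π I) ⁻¹ᵁ ⊤),
        (j ≫ affineBlowup.π I).appLE ⊤ ⊤ h =
          (Spec.map (CommRingCat.ofHom (reesChartBase b hb))).appTop := by
      rw [affineBlowup.chartι_π]
      intro h
      exact (Scheme.Hom.app_eq_appLE _).symm
    rw [key, Scheme.ΓSpecIso_naturality]
  refine RingHom.ext fun s => ?_
  have hs := congrArg (fun F : Γ(Spec (.of R), ⊤) ⟶ CommRingCat.of B => F.hom s) hcomp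
  simp only [CommRingCat.hom_comp, RingHom.comp_apply, CommRingCat.hom_ofHom] at hs
  exact hs

/-! ## The affine case: the exceptional divisor of `Bl_{(x)}(Spec R)` is flat over the base -/

section Affine

variable {R : Type u} [CommRing R] {r : ℕ} (x : Fin r → R)

local notation3 "𝓘" => Ideal.span (Set.range x)

/-- **The exceptional divisor of the blow-up along a quasi-regular centre is flat over any base over which the
centre is flat** (chartwise content of Liu, Thm. 8.1.19 (b): `E = ℙ(C_{Y/X})` is a projective bundle over the
centre `Y`): for `x` quasi-regular in `R`, `I = (x)`, and `θ : D → R` with `D → R/I` flat, the composite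
`E = V(I · 𝒪) ⊆ Bl_I(Spec R) → Spec R → Spec D` is flat. Indeed `E` is covered by its affine pieces over the charts
`D₊(xᵢt)`, spectra of `(R[It])_{(xᵢt)}/(xᵢ) ≅ (R/I)[T_j : j ≠ i]`. [cite: Liu2002, Thm. 8.1.19 (b)] -/
theorem flat_exceptional_affineBlowup_of_isQuasiRegular (hx : IsQuasiRegular x) {D : Type u} [CommRing D]
    (θ : D →+* R) (hθ : ((Ideal.Quotient.mk 𝓘).comp θ).Flat) :
    Flat ((affineBlowup.exceptionalIdeal 𝓘).subschemeι ≫ affineBlowup.π 𝓘 ≫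
      Spec.map (CommRingCat.ofHom θ)) := by
  -- the charts `D₊(xᵢ t)` at the generators
  let U : Fin r → (affineBlowup 𝓘).affineOpens := fun i =>
    affineBlowup.chartOpen (I := 𝓘) (x i) (Ideal.mem_span_range_self (f := x) (x := i))
  refine HasRingHomProperty.of_iSup_eq_top (P := @Flat)
    (fun i => ⟨(affineBlowup.exceptionalIdeal 𝓘).subschemeι ⁻¹ᵁ (U i : (affineBlowup 𝓘).Opens),
      (U i).2.preimage _⟩) ?_ fun i => ?_
  · -- the pieces `E ∩ D₊(xᵢ t)` cover `E`
    change ⨆ i, (affineBlowup.exceptionalIdeal 𝓘).subschemeι ⁻¹ᵁ (U i : (affineBlowup 𝓘).Opens) = ⊤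
    rw [← Scheme.Hom.preimage_iSup]
    have hcov : ⨆ i, (U i : (affineBlowup 𝓘).Opens) = ⊤ := by
      rw [← affineBlowup.iSup_basicOpen_reesT_generators_eq_top x]
      exact iSup_congr fun i => affineBlowup.image_top_chartι (I := 𝓘) (x i) _
    rw [hcov]
    rfl
  · -- the ring map `Γ(Spec D, ⊤) → Γ(E, E ∩ D₊(xᵢ t))` is `D → (R[It])_{(xᵢt)}/(xᵢ)` up to isomorphisms
    obtain ⟨E, hEbij, hE1, hE2⟩ :=
      exists_ringHom_exceptional_chartOpen (I := 𝓘) (x i) (Ideal.mem_span_range_self (f := x) (x := i))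
    refine (flat_appLE_subschemeι_comp_iff (affineBlowup.exceptionalIdeal 𝓘)
      (affineBlowup.π 𝓘 ≫ Spec.map (CommRingCat.ofHom θ)) (U i) E hEbij _ hE1).mpr ?_
    -- `E ∘ (π ≫ Spec θ)^* = φᵢ ∘ θ ∘ (Γ(Spec D, ⊤) ≅ D)`
    have key : E.comp ((affineBlowup.π 𝓘 ≫ Spec.map (CommRingCat.ofHom θ)).appLE ⊤ (U i)
        le_top).hom = ((reesChartBase (x i) (Ideal.mem_span_range_self (f := x) (x := i))).comp θ).comp
          (Scheme.ΓSpecIso (.of D)).hom.hom := by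
      refine RingHom.ext fun s => ?_
      have hnat : (Scheme.ΓSpecIso (.of R)).hom.hom ((Spec.map (CommRingCat.ofHom θ)).appTop.hom s) =
          θ ((Scheme.ΓSpecIso (.of D)).hom.hom s) := by
        rw [← RingHom.comp_apply, ← CommRingCat.hom_comp, Scheme.ΓSpecIso_naturality, CommRingCat.hom_comp,
          RingHom.comp_apply, CommRingCat.hom_ofHom]
      have hE2' : E (((affineBlowup.π 𝓘).appLE ⊤ (U i) le_top).hom
          ((Spec.map (CommRingCat.ofHom θ)).appTop.hom s)) =
          reesChartBase (x i) (Ideal.mem_span_range_self (f := x) (x := i))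
            ((Scheme.ΓSpecIso (.of R)).hom.hom ((Spec.map (CommRingCat.ofHom θ)).appTop.hom s)) :=
        congrArg (fun F : Γ(Spec (.of R), ⊤) →+* _ => F ((Spec.map (CommRingCat.ofHom θ)).appTop.hom s)) hE2
      rw [hnat] at hE2'
      refine Eq.trans ?_ hE2'
      change E (((affineBlowup.π 𝓘 ≫ Spec.map (CommRingCat.ofHom θ)).appLE ⊤ (U i) le_top).hom s) = _
      rw [Scheme.Hom.comp_appLE, CommRingCat.hom_comp, RingHom.comp_apply]
      rfl
    have hG : ((Ideal.Quotient.mk (Ideal.span {reesChartBase (x i)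
        (Ideal.mem_span_range_self (f := x) (x := i)) (x i)})).comp
        (((reesChartBase (x i) (Ideal.mem_span_range_self (f := x) (x := i))).comp θ).comp
          (Scheme.ΓSpecIso (.of D)).hom.hom)).Flat := by
      rw [← RingHom.comp_assoc, RingHom.Flat.comp_iff_of_bijective_right
        (Scheme.ΓSpecIso (.of D)).commRingCatIsoToRingEquiv.bijective]
      exact flat_quotient_chart_comp x i hx θ hθ
    rw [← key] at hG
    exact hG

end Affine

/-! ## The affine case as a registered sub-goal (universe `0`) -/

/-- **The same for any blow-up of an affine scheme along a quasi-regular centre**: let `Y` be affine, `J` an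
ideal sheaf on `Y` whose ideal of global sections is generated by a quasi-regular sequence `x`, `π : X' → Y` a
blow-up along `J` (`IsBlowup`), and `q : Y → Spec D` such that `D → Γ(Y, 𝒪)/(x)` is flat. Then the exceptional
divisor `V(J · 𝒪_{X'}) → Spec D` is flat: transport along `Y ≅ Spec Γ(Y, 𝒪)` and the uniqueness of blow-ups
(`affineBlowup.isBlowup`, `IsBlowup.unique`). [cite: Liu2002, Thm. 8.1.19 (b)] -/
theorem flat_exceptional_of_isBlowup_of_isAffine : ∀ (Y X' : AlgebraicGeometry.Scheme.{0}) [AlgebraicGeometry.IsAffine Y] (J : Y.IdealSheafData) (c : ℕ) (y : Fin c → Y.presheaf.obj (Opposite.op ⊤)), J.ideal ⟨⊤, AlgebraicGeometry.isAffineOpen_top Y⟩ = Ideal.span (Set.range y) → Literature.AlgebraicGeometry.Resolution.IsQuasiRegular y → ∀ (π : X' ⟶ Y), Literature.AlgebraicGeometry.Resolution.IsBlowup π J → ∀ (D : Type) [CommRing D] (q : Y ⟶ AlgebraicGeometry.Spec (.of D)), ((Ideal.Quotient.mk (Ideal.span (Set.range y))).comp (CategoryTheory.CategoryStruct.comp (AlgebraicGeometry.Scheme.ΓSpecIso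 (.of D)).inv q.appTop).hom).Flat → AlgebraicGeometry.Flat (CategoryTheory.CategoryStruct.comp (J.comap π).subschemeι (CategoryTheory.CategoryStruct.comp π q)) := by
  intro Y X' _ J c y hJ hy π hπ D _ q hflat
  -- adapted from Literature.AlgebraicGeometry.Resolution.IsBlowup.isRegular_of_isAffine_of_isQuasiRegular
  let e := Y.isoSpec
  have h1 : IsBlowup (π ≫ e.hom) (J.comap e.inv) := hπ.comp_iso e
  have hJ' : Scheme.IdealSheafData.ofIdealTop (J.ideal ⟨⊤, isAffineOpen_top Y⟩) = J :=
    Scheme.IdealSheafData.ext_of_isAffine (by rw [ideal_ofIdealTop_top])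
  have happ : e.inv.appTop = (Scheme.ΓSpecIso Γ(Y, ⊤)).inv := by
    have h2 : e.hom.appTop ≫ e.inv.appTop = 𝟙 _ := by
      rw [← Scheme.Hom.comp_appTop, e.inv_hom_id, Scheme.Hom.id_appTop]
    rw [show e.hom = Y.toSpecΓ from rfl, Scheme.toSpecΓ_appTop] at h2
    exact (Iso.hom_comp_eq_id _).mp h2
  have hK : J.comap e.inv = affineBlowup.idealSheaf (R := Γ(Y, ⊤)) (Ideal.span (Set.range y)) := by
    rw [← hJ', comap_ofIdealTop_of_isAffine, hJ, happ]
    rfl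
  rw [hK] at h1
  obtain ⟨e', he', -⟩ := h1.unique (affineBlowup.isBlowup (Ideal.span (Set.range y)))
  -- the ring map of `q`
  set θ : D →+* Γ(Y, ⊤) := ((Scheme.ΓSpecIso (.of D)).inv ≫ q.appTop).hom with hθ
  have hq : q = e.hom ≫ Spec.map (CommRingCat.ofHom θ) := by
    rw [hθ, CommRingCat.ofHom_hom]
    exact eq_toSpecΓ_SpecMap q
  have hcomap : J.comap π = (affineBlowup.exceptionalIdeal (Ideal.span (Set.range y))).comap e'.hom := by
    rw [affineBlowup.exceptionalIdeal, ← Scheme.IdealSheafData.comap_comp, he', ← hK,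
      ← Scheme.IdealSheafData.comap_comp, Category.assoc, e.hom_inv_id, Category.comp_id]
  have hmor : π ≫ q = e'.hom ≫ affineBlowup.π _ ≫ Spec.map (CommRingCat.ofHom θ) := by
    rw [hq, ← Category.assoc, ← he', Category.assoc]
  rw [hcomap, hmor]
  haveI := flat_exceptional_affineBlowup_of_isQuasiRegular y hy θ hflat
  exact flat_comap_subschemeι_comp e'.hom _ _

end Summit.ResolutionOfSingularities.ResolutionOfSingularities.Cruxes.EquisingularLift.StrataSplit

end
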